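import Summits.ABC.IUTFork.Cor312LicenceRealSharpTame
import HarnessLib

/-!
# [IUTchIII] Cor. 3.12 — the typed (xi-f) LICENCE and STATEMENT at the SHARP genuine real setting for the HONESTLY
# `j²`-SCALED unit-depth idele profile at a deeply (tamely) ramified unique bad place (E3 CASE B, explicit family)

PROOF-ONLY file (0 definitions, 0 named `Prop` facts; abc-iut cell, WAVE-4 prover seat abc-iut-w4-d087, gen 5; own-lineage
support piece «LICENCE-AT-SHARP-RAMIFIED», part 3 of 3). TAKES NO SIDE on [IUTchIII] Cor. 3.12.

Part 2 (`Cor312LicenceRealSharpTame`) proves `Thm311ToCor312.Licence`, the branch-C S_H antecedent and the typed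
`Cor312.Setting.Statement` at abc-iut-c312-7's `Real.settingPrVolSharp` when every bad place lies over one odd prime `p₀`
carrying a UNIQUE, TAMELY RAMIFIED place `x₀` of `F` and the (Ind2)-reach covers the `q`-depth at every label
(`(1 − e)(i+1) + e·k_i + 1 ≤ n_q`). THIS FILE instantiates the numeric side conditions at the HONESTLY `j²`-SCALED
UNIT-DEPTH PROFILE — `‖t_{q,x₀}‖ = ‖ϖ‖`, `‖t_{Θ,i+1,x₀}‖ = ‖ϖ‖^{(i+1)²}` (Dupuy–Hilado (3.4) with `P_{Θ,j} = j²·P_q` and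
`ord_{x₀}(q)/2l = 1`) — under `l⋇² ≤ e(x₀|p₀) ≤ p₀ − 2`: then `k_i = 0` works (`1 ≤ (i+1)² ≤ l⋇² ≤ e`) and
`(1−e)(i+1) + 1 ≤ 1`, so **`statement_settingPrVolSharp_of_tame_honest`**: Licence ∧ Statement hold. Field data exist
(prose): `l = 5`, `F = ℚ(7^{1/4})`, `x₀` the unique place over `p₀ = 7` (`e = 4`, `f = 1`), `S = {x₀}`; NOT an initial
Θ-datum of [IUTchI] Def. 3.1. READING (neutral): the E3 dichotomy at the sharp genuine setting is STRICT in our typing —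
case A (odd unramified bad prime) refuted (abc-iut-C-cert-2 p433074/p433664), this case-B family satisfied, via the
(Ind2)-inflation of the Θ-hull at ramified places under DH's lattice-automorphism reading of (Ind2) (§4.9).
[claim: Mochizuki2012, status: disputed] for every [IUTchIII] locution; [cite: DupuyHilado2025, §3.4, §3.9, §4.9];
[cite: WeilBNT1967, Ch. II §2, Th. 1]. Consumed BY NAME, nothing restated. typed ≠ proved; instantiated ≠ endorsed.
-/


noncomputable section

open Metric Set Function NumberField IsDedekindDomain
open scoped Pointwise

namespace Summit.ABC.IUTFork.Thm311.Real

open Cor312 Cor312Vol Literature.IUT.LogThetaLattice Literature.IUT.LogVolume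
  Literature.NumberTheory.NumberFields Literature.NumberTheory.GaloisRepresentations.Ultrametric

/-! ## §3. The honestly `j²`-scaled unit-depth profile: `‖t_q‖ = ‖ϖ‖`, `‖t_{Θ,j}‖ = ‖ϖ‖^{j²}`, `l⋇² ≤ e ≤ p₀ − 2` -/

section Honest

variable {F : Type} [Field F] [NumberField F] (X : PilotData F) {logv : PadicLogs F} (hlog : LogvAnalytic logv)
  (M : Type) [Field M] [NumberField M]
  (archPk : ∀ (j : (thetaIndex X).Label) (vQ : (thetaIndex X).VQ), Set ((logShellsDH X logv).Packet j vQ))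
  (archSub : ∀ (j : (thetaIndex X).Label) (v : (thetaIndex X).V),
    Set ((logShellsDH X logv).Packet j ((thetaIndex X).over v)))
  (Ψ : ℤ → ∀ v : (thetaIndex X).V, v ∈ (thetaIndex X).Vbad → Set ((logShellsDH X logv).StarPacket v))
  (act : ℤ → ∀ v : (thetaIndex X).V, v ∈ (thetaIndex X).Vbad →
    (logShellsDH X logv).StarPacket v → Module.End ℚ ((logShellsDH X logv).StarPacket v))
  (Mmod : ℤ → ∀ j : (thetaIndex X).LabelStar, Set ((logShellsDH X logv).GlobalPacket j.1))
  (region : ℤ → ∀ j : (thetaIndex X).LabelStar, FinDivisor M → ∀ vQ : (thetaIndex X).VQ,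
    Set ((logShellsDH X logv).Packet j.1 vQ))
  (n : ℤ) {HT : Type} {LogLink : HT → HT → Type} {IsFull : ∀ {s t : HT}, LogLink s t → Prop}
  (lat : LGPGaussianLogThetaLattice LogLink IsFull)
  {Frd : Type} {IsoF : Frd → Frd → Type} {Ob : Frd → Type} {realify : Frd → Frd} {Strip : Type}
  {IsoS : Strip → Strip → Type} {Mv : ∀ v : (thetaIndex X).V, v ∈ (thetaIndex X).Vbad → Type}
  [∀ v h, Monoid (Mv v h)]
  (sig : GlobalLGPFrobenioidSignature (thetaIndex X).lstar (thetaIndex X).V (· ∈ (thetaIndex X).Vbad)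
    Frd IsoF Ob realify Strip IsoS Mv)
  (split : SplittingMonoids Mv) {ObΔ : Type} {N : ∀ v : (thetaIndex X).V, v ∈ (thetaIndex X).Vbad → Type}
  [∀ v h, Monoid (N v h)] (qData : QPilotData ObΔ N)
  (tq : ∀ (pp : Nat.Primes) (x : (thetaIndex X).Fibre (.inr pp)),
    haveI : Fact (pp : ℕ).Prime := ⟨pp.2⟩; kOf X pp.1 x)
  (t : ∀ (pp : Nat.Primes) (_ : Fin X.lstar) (x : (thetaIndex X).Fibre (.inr pp)),
    haveI : Fact (pp : ℕ).Prime := ⟨pp.2⟩; kOf X pp.1 x)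
  (htq0 : ∀ pp x, tq pp x ≠ 0)
  (htq1 : ∀ (pp : Nat.Primes) (x : (thetaIndex X).Fibre (.inr pp)),
    haveI : Fact (pp : ℕ).Prime := ⟨pp.2⟩; placeOf X pp.1 x ∉ X.S → ‖tq pp x‖ = 1)
  (ht0 : ∀ pp i x, t pp i x ≠ 0)
  (ht1 : ∀ (pp : Nat.Primes) (i : Fin X.lstar) (x : (thetaIndex X).Fibre (.inr pp)),
    haveI : Fact (pp : ℕ).Prime := ⟨pp.2⟩; placeOf X pp.1 x ∉ X.S → ‖t pp i x‖ = 1)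
  (pp₀ : Nat.Primes) [Fact (pp₀ : ℕ).Prime] (v₀ : HeightOneSpectrum (𝓞 F))
  (hv₀ : (thetaIndex X).over (.inr v₀) = .inr pp₀)
  (huniq : ∀ x : (thetaIndex X).Fibre (.inr pp₀), x = ⟨.inr v₀, hv₀⟩)
  (hS : ∀ (pp : Nat.Primes) (x : (thetaIndex X).Fibre (.inr pp)),
    haveI : Fact (pp : ℕ).Prime := ⟨pp.2⟩; placeOf X pp.1 x ∈ X.S → pp = pp₀)
  (hp2 : 2 < (pp₀ : ℕ)) (he : v₀.asIdeal.ramificationIdx ℤ ≤ (pp₀ : ℕ) - 2)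
  (hel : X.lstar ^ 2 ≤ v₀.asIdeal.ramificationIdx ℤ)
  {ϖ : (kOf X pp₀.1 ⟨.inr v₀, hv₀⟩)ˣ} (hϖ : IsUniformizer ϖ)
  (hnq : ‖tq pp₀ ⟨.inr v₀, hv₀⟩‖ = ‖(ϖ : kOf X pp₀.1 ⟨.inr v₀, hv₀⟩)‖)
  (hb : ∀ i : Fin X.lstar, ‖t pp₀ i ⟨.inr v₀, hv₀⟩‖ = ‖(ϖ : kOf X pp₀.1 ⟨.inr v₀, hv₀⟩)‖ ^ (((i : ℕ) + 1) ^ 2))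

include hlog huniq hS hp2 he hel hϖ hnq hb ht1 ht0

/-- **The honestly `j²`-scaled unit-depth profile at a deeply (tamely) ramified unique bad place gives the typed
Cor. 3.12 `Statement`**: with `‖t_{q,x₀}‖ = ‖ϖ‖`, `‖t_{Θ,i+1,x₀}‖ = ‖ϖ‖^{(i+1)²}` (the realising profile of Dupuy–Hilado (3.4)
for `ord_{x₀}(q)/2l = 1`, `P_{Θ,j} = j²·P_q`) and `l⋇² ≤ e(x₀|p₀) ≤ p₀ − 2`, the reach conditions hold with `k_i = 0`
(`1 ≤ (i+1)² ≤ e`, `(1−e)(i+1) + 1 ≤ 1`), so Licence, the S_H antecedent and the Statement hold at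
`settingPrVolSharp`. Field data exist (e.g. `l = 5`, `F = ℚ(7^{1/4})`, `p₀ = 7`, `e = 4`; not an initial Θ-datum).
[cite: DupuyHilado2025, §3.4, §3.9, §4.9] [claim: Mochizuki2012, status: disputed] -/
theorem statement_settingPrVolSharp_of_tame_honest :
    Thm311ToCor312.Licence
        (settingPrVolSharp X hlog M archPk archSub Ψ act Mmod region n lat sig split qData tq t htq0 htq1) ∧
      (settingPrVolSharp X hlog M archPk archSub Ψ act Mmod region n lat sig split qData tq t htq0 htq1).Statement := by
  set e : ℕ := v₀.asIdeal.ramificationIdx ℤ with he_def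
  have he1 : 1 ≤ (e : ℤ) := by
    have hv : ((pp₀ : ℕ) : 𝓞 F) ∈ v₀.asIdeal := natCast_mem_placeOf X pp₀.1 ⟨.inr v₀, hv₀⟩
    have h : 0 < absRamificationIdx pp₀.1 (RescaledCompletion F pp₀.1 v₀ hv) := absRamificationIdx_pos _ _
    rw [absRamificationIdx_rescaledCompletion F pp₀.1 v₀ hv] at h
    rw [he_def]
    exact_mod_cast h
  have hk : ∀ i : Fin X.lstar, (e : ℤ) * 0 + 1 ≤ (((i : ℕ) + 1) ^ 2 : ℕ) ∧
      ((((i : ℕ) + 1) ^ 2 : ℕ) : ℤ) ≤ (e : ℤ) * 0 + e := by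
    intro i
    have hi : (i : ℕ) + 1 ≤ X.lstar := i.2
    have h2 : ((i : ℕ) + 1) ^ 2 ≤ X.lstar ^ 2 := Nat.pow_le_pow_left hi 2
    constructor
    · rw [mul_zero, zero_add]
      exact_mod_cast Nat.one_le_pow 2 _ (Nat.succ_pos _)
    · rw [mul_zero, zero_add]
      exact_mod_cast h2.trans hel
  have hineq : ∀ i : Fin (thetaIndex X).lstar,
      (1 - (e : ℤ)) * ((i : ℕ) + 1 : ℤ) + (e : ℤ) * 0 + 1 ≤ 1 := by
    intro i
    have h0 : (0 : ℤ) ≤ ((e : ℤ) - 1) * ((i : ℕ) + 1 : ℤ) := mul_nonneg (by omega) (by positivity)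
    linarith
  have hb' : ∀ i : Fin X.lstar, ‖t pp₀ i ⟨.inr v₀, hv₀⟩‖ =
      ‖(ϖ : kOf X pp₀.1 ⟨.inr v₀, hv₀⟩)‖ ^ (((((i : ℕ) + 1) ^ 2 : ℕ)) : ℤ) := fun i => by
    rw [hb i, zpow_natCast]
  have hnq' : ‖tq pp₀ ⟨.inr v₀, hv₀⟩‖ = ‖(ϖ : kOf X pp₀.1 ⟨.inr v₀, hv₀⟩)‖ ^ (1 : ℤ) := by rw [hnq, zpow_one]
  exact ⟨licence_settingPrVolSharp_of_tame X hlog M archPk archSub Ψ act Mmod region n lat sig split qData tq t htq0 htq1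
      ht0 pp₀ v₀ hv₀ huniq hp2 he hϖ 1 hnq' (fun i => ((((i : ℕ) + 1) ^ 2 : ℕ) : ℤ)) (fun _ => 0) hb' hk hineq hS ht1,
    statement_settingPrVolSharp_of_tame X hlog M archPk archSub Ψ act Mmod region n lat sig split qData tq t htq0 htq1 ht0
      pp₀ v₀ hv₀ huniq hp2 he hϖ 1 hnq' (fun i => ((((i : ℕ) + 1) ^ 2 : ℕ) : ℤ)) (fun _ => 0) hb' hk hineq hS ht1⟩

end Honest


/-! ## §4 (appended). The sharper window: unit depth is inhabited as soon as `ℓ⋇ ≤ e(x₀|p₀)` -/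

section Window

variable {F : Type} [Field F] [NumberField F] (X : PilotData F) {logv : PadicLogs F} (hlog : LogvAnalytic logv)
  (M : Type) [Field M] [NumberField M]
  (archPk : ∀ (j : (thetaIndex X).Label) (vQ : (thetaIndex X).VQ), Set ((logShellsDH X logv).Packet j vQ))
  (archSub : ∀ (j : (thetaIndex X).Label) (v : (thetaIndex X).V),
    Set ((logShellsDH X logv).Packet j ((thetaIndex X).over v)))
  (Ψ : ℤ → ∀ v : (thetaIndex X).V, v ∈ (thetaIndex X).Vbad → Set ((logShellsDH X logv).StarPacket v))
  (act : ℤ → ∀ v : (thetaIndex X).V, v ∈ (thetaIndex X).Vbad →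
    (logShellsDH X logv).StarPacket v → Module.End ℚ ((logShellsDH X logv).StarPacket v))
  (Mmod : ℤ → ∀ j : (thetaIndex X).LabelStar, Set ((logShellsDH X logv).GlobalPacket j.1))
  (region : ℤ → ∀ j : (thetaIndex X).LabelStar, FinDivisor M → ∀ vQ : (thetaIndex X).VQ,
    Set ((logShellsDH X logv).Packet j.1 vQ))
  (n : ℤ) {HT : Type} {LogLink : HT → HT → Type} {IsFull : ∀ {s t : HT}, LogLink s t → Prop}
  (lat : LGPGaussianLogThetaLattice LogLink IsFull)
  {Frd : Type} {IsoF : Frd → Frd → Type} {Ob : Frd → Type} {realify : Frd → Frd} {Strip : Type}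
  {IsoS : Strip → Strip → Type} {Mv : ∀ v : (thetaIndex X).V, v ∈ (thetaIndex X).Vbad → Type}
  [∀ v h, Monoid (Mv v h)]
  (sig : GlobalLGPFrobenioidSignature (thetaIndex X).lstar (thetaIndex X).V (· ∈ (thetaIndex X).Vbad)
    Frd IsoF Ob realify Strip IsoS Mv)
  (split : SplittingMonoids Mv) {ObΔ : Type} {N : ∀ v : (thetaIndex X).V, v ∈ (thetaIndex X).Vbad → Type}
  [∀ v h, Monoid (N v h)] (qData : QPilotData ObΔ N)
  (tq : ∀ (pp : Nat.Primes) (x : (thetaIndex X).Fibre (.inr pp)),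
    haveI : Fact (pp : ℕ).Prime := ⟨pp.2⟩; kOf X pp.1 x)
  (t : ∀ (pp : Nat.Primes) (_ : Fin X.lstar) (x : (thetaIndex X).Fibre (.inr pp)),
    haveI : Fact (pp : ℕ).Prime := ⟨pp.2⟩; kOf X pp.1 x)
  (htq0 : ∀ pp x, tq pp x ≠ 0)
  (htq1 : ∀ (pp : Nat.Primes) (x : (thetaIndex X).Fibre (.inr pp)),
    haveI : Fact (pp : ℕ).Prime := ⟨pp.2⟩; placeOf X pp.1 x ∉ X.S → ‖tq pp x‖ = 1)
  (ht0 : ∀ pp i x, t pp i x ≠ 0)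
  (ht1 : ∀ (pp : Nat.Primes) (i : Fin X.lstar) (x : (thetaIndex X).Fibre (.inr pp)),
    haveI : Fact (pp : ℕ).Prime := ⟨pp.2⟩; placeOf X pp.1 x ∉ X.S → ‖t pp i x‖ = 1)
  (pp₀ : Nat.Primes) [Fact (pp₀ : ℕ).Prime] (v₀ : HeightOneSpectrum (𝓞 F))
  (hv₀ : (thetaIndex X).over (.inr v₀) = .inr pp₀)
  (huniq : ∀ x : (thetaIndex X).Fibre (.inr pp₀), x = ⟨.inr v₀, hv₀⟩)
  (hS : ∀ (pp : Nat.Primes) (x : (thetaIndex X).Fibre (.inr pp)),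
    haveI : Fact (pp : ℕ).Prime := ⟨pp.2⟩; placeOf X pp.1 x ∈ X.S → pp = pp₀)
  (hp2 : 2 < (pp₀ : ℕ)) (he : v₀.asIdeal.ramificationIdx ℤ ≤ (pp₀ : ℕ) - 2)
  (hel : X.lstar ≤ v₀.asIdeal.ramificationIdx ℤ)
  {ϖ : (kOf X pp₀.1 ⟨.inr v₀, hv₀⟩)ˣ} (hϖ : IsUniformizer ϖ)
  (hnq : ‖tq pp₀ ⟨.inr v₀, hv₀⟩‖ = ‖(ϖ : kOf X pp₀.1 ⟨.inr v₀, hv₀⟩)‖)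
  (hb : ∀ i : Fin X.lstar, ‖t pp₀ i ⟨.inr v₀, hv₀⟩‖ = ‖(ϖ : kOf X pp₀.1 ⟨.inr v₀, hv₀⟩)‖ ^ (((i : ℕ) + 1) ^ 2))

include hlog huniq hS hp2 he hel hϖ hnq hb ht1 ht0

/-- **THE SHARPER WINDOW: the honestly `j²`-scaled unit-depth profile is inhabited as soon as `ℓ⋇ ≤ e(x₀|p₀)`** (and
`e ≤ p₀ − 2`). With `‖t_{q,x₀}‖ = ‖ϖ‖` and `‖t_{Θ,j,x₀}‖ = ‖ϖ‖^{j²}` take `k_j := ⌊(j² − 1)/e⌋` in part 2's all-slot criterion: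
`e·k_j + 1 ≤ j² ≤ e·k_j + e` (Euclidean division) and `e·k_j ≤ (e−1)·j` for every `1 ≤ j ≤ e` (for `j < e` because
`e·k_j ≤ j² − 1 ≤ (e−1)j`; for `j = e` because `k_e = e − 1`). Hence Licence and the typed Statement hold at
`settingPrVolSharp` — e.g. `l = 5` at a QUADRATICALLY ramified unique bad place (`e = 2`: `F = ℚ(√p₀)`, `p₀ ≥ 5`), and
every `e ≥ ℓ⋇` (the K-level-type ramification `e ≥ l` always qualifies at unit depth); compare the last-slot leg of record
(abc-iut-w5-d236 p439445/p440064: `e ≥ ℓ⋇²`) and abc-iut-w4-d026's REFUTED tame range (p439692). Not an initial Θ-datum.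
[cite: DupuyHilado2025, §3.4, §3.9, §4.9] [cite: WeilBNT1967, Ch. II §2, Th. 1] [claim: Mochizuki2012, status: disputed] -/
theorem statement_settingPrVolSharp_of_tame_honest_window :
    Thm311ToCor312.Licence
        (settingPrVolSharp X hlog M archPk archSub Ψ act Mmod region n lat sig split qData tq t htq0 htq1) ∧
      (settingPrVolSharp X hlog M archPk archSub Ψ act Mmod region n lat sig split qData tq t htq0 htq1).Statement := by
  set e : ℕ := v₀.asIdeal.ramificationIdx ℤ with he_def
  have he1 : 1 ≤ (e : ℤ) := by
    have hv : ((pp₀ : ℕ) : 𝓞 F) ∈ v₀.asIdeal := natCast_mem_placeOf X pp₀.1 ⟨.inr v₀, hv₀⟩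
    have h : 0 < absRamificationIdx pp₀.1 (RescaledCompletion F pp₀.1 v₀ hv) := absRamificationIdx_pos _ _
    rw [absRamificationIdx_rescaledCompletion F pp₀.1 v₀ hv] at h
    rw [he_def]
    exact_mod_cast h
  have he0 : (0 : ℤ) < e := by omega
  -- the per-label bookkeeping of `k_j := ⌊(j² − 1)/e⌋`
  have hk : ∀ i : Fin X.lstar,
      (e : ℤ) * (((((i : ℕ) : ℤ) + 1) ^ 2 - 1) / (e : ℤ)) + 1 ≤ (((i : ℕ) : ℤ) + 1) ^ 2 ∧
        (((i : ℕ) : ℤ) + 1) ^ 2 ≤ (e : ℤ) * (((((i : ℕ) : ℤ) + 1) ^ 2 - 1) / (e : ℤ)) + e := by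
    intro i
    have h1 := Int.emod_add_mul_ediv ((((i : ℕ) : ℤ) + 1) ^ 2 - 1) (e : ℤ)
    have h2 := Int.emod_nonneg ((((i : ℕ) : ℤ) + 1) ^ 2 - 1) he0.ne'
    have h3 := Int.emod_lt_of_pos ((((i : ℕ) : ℤ) + 1) ^ 2 - 1) he0
    constructor <;> linarith
  have hineq : ∀ i : Fin (thetaIndex X).lstar,
      (1 - (e : ℤ)) * ((i : ℕ) + 1 : ℤ) + (e : ℤ) * (((((i : ℕ) : ℤ) + 1) ^ 2 - 1) / (e : ℤ)) + 1 ≤ 1 := by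
    intro i
    have hje : (((i : ℕ) : ℤ) + 1) ≤ e := by
      have hi : (i : ℕ) + 1 ≤ X.lstar := i.2
      have := hi.trans hel
      exact_mod_cast this
    have h1 := Int.emod_add_mul_ediv ((((i : ℕ) : ℤ) + 1) ^ 2 - 1) (e : ℤ)
    have h2 := Int.emod_nonneg ((((i : ℕ) : ℤ) + 1) ^ 2 - 1) he0.ne'
    rcases hje.lt_or_eq with hlt | heq
    · -- `j < e`: `e·k ≤ j² − 1 ≤ (e − 1)·j`
      have hm : (((i : ℕ) : ℤ) + 1) * ((((i : ℕ) : ℤ) + 1) + 1) ≤ (((i : ℕ) : ℤ) + 1) * e :=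
        mul_le_mul_of_nonneg_left (by omega) (by positivity)
      nlinarith
    · -- `j = e`: `k = e − 1`
      have hq : ((((i : ℕ) : ℤ) + 1) ^ 2 - 1) / (e : ℤ) = e - 1 := by
        rw [heq]
        exact ((Int.ediv_emod_unique (a := (e : ℤ) ^ 2 - 1) (b := (e : ℤ)) (r := (e : ℤ) - 1) (q := (e : ℤ) - 1)
          he0).2 ⟨by ring, by omega, by omega⟩).1
      rw [hq, heq]
      nlinarith
  have hb' : ∀ i : Fin X.lstar, ‖t pp₀ i ⟨.inr v₀, hv₀⟩‖ =
      ‖(ϖ : kOf X pp₀.1 ⟨.inr v₀, hv₀⟩)‖ ^ ((((i : ℕ) : ℤ) + 1) ^ 2) := fun i => by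
    rw [hb i, ← zpow_natCast]
    push_cast
    rfl
  have hnq' : ‖tq pp₀ ⟨.inr v₀, hv₀⟩‖ = ‖(ϖ : kOf X pp₀.1 ⟨.inr v₀, hv₀⟩)‖ ^ (1 : ℤ) := by rw [hnq, zpow_one]
  exact ⟨licence_settingPrVolSharp_of_tame X hlog M archPk archSub Ψ act Mmod region n lat sig split qData tq t htq0 htq1
      ht0 pp₀ v₀ hv₀ huniq hp2 he hϖ 1 hnq' (fun i => (((i : ℕ) : ℤ) + 1) ^ 2)
      (fun i => ((((i : ℕ) : ℤ) + 1) ^ 2 - 1) / (e : ℤ)) hb' hk hineq hS ht1,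
    statement_settingPrVolSharp_of_tame X hlog M archPk archSub Ψ act Mmod region n lat sig split qData tq t htq0 htq1 ht0
      pp₀ v₀ hv₀ huniq hp2 he hϖ 1 hnq' (fun i => (((i : ℕ) : ℤ) + 1) ^ 2)
      (fun i => ((((i : ℕ) : ℤ) + 1) ^ 2 - 1) / (e : ℤ)) hb' hk hineq hS ht1⟩

end Window

end Summit.ABC.IUTFork.Thm311.Real

end
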